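import Literature.AlgebraicGeometry.Resolution.MacaulayficationPStandard
import HarnessLib

/-!
# `p`-standard systems of parameters are `d`-sequences on `M/(y)M` (Kawasaki 2000, Thm. 2.9, Cor. 2.10)

Topic: `Literature/AlgebraicGeometry/Resolution`. Brick of the proof of the named facts
`KawasakiMacaulayfication` / `CesnaviciusMacaulayfication`; sequel of
`MacaulayficationPStandard.lean` (`IsPStandard`, `KillsParameterColons`). This file formalizes,
following the printed proofs line by line,

* **Kawasaki 2000, Theorem 2.9** (`IsPStandard.colonBy_mul_eq_colonBy`): for a `p`-standard
  `x₁,…,x_d` (type `d-1`), a subsystem of parameters `y₁,…,y_u` of `M/(xᵢ,…,x_d)M` whose last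
  element `y_u` kills the parameter colons of `M` or of `M/(xᵢ,…,x_d)M`, every `v ≤ u` and every
  `Λ ⊆ {i,…,d}`: `(y₁,…,y_{v-1}, x_Λ)M : y_vy_u = (y₁,…,y_{v-1}, x_Λ)M : y_u` — proof by
  induction on `#({i,…,d} ∖ Λ)` through its largest element `l`, exactly as printed;
* **Kawasaki 2000, Corollary 2.10** (`IsPStandard.isKDSequence`): for every subsystem of
  parameters `y₁,…,y_u` of `M/(xᵢ,…,x_d)M`, the sequence `xᵢ,…,x_d` is a `d`-sequence on
  `M/(y₁,…,y_u)M` (Kawasaki's form `IsKDSequence`; the tree's `IsDSequence` on the quotient by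
  `isKDSequence_iff_isDSequence_quotient`). This is property (KI-b) of Česnavičius 2021,
  Thm. 3.10 ("`r_s,…,r₁` is a `d`-sequence for `M'`"), the input of Claim 3.13.2 there and of
  Kawasaki 2000, Lemma 4.3 (1).

Conventions: `xs = X₀ ++ D` with `D = (xᵢ,…,x_d)`; "`ys` is a subsystem of parameters of
`M/(D)M`" is rendered `IsSecantSequence M (D ++ ys)` (cf. `isSecantSequence_append_iff`);
`x_Λ` for `Λ ⊆ {i,…,d}` is a sublist `L` of `D`; indices are `0`-based (`ys.take m`, `ys[m]`).
Everything is proved; no named fact is introduced.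

## References

* [Kawasaki2000] T. Kawasaki, *On Macaulayfication of Noetherian schemes*, Trans. AMS 352 (2000)
  2517–2552, Thm. 2.9, Cor. 2.10 (with their proofs, pp. 2521–2522).
* [Cesnavicius2021] K. Česnavičius, Duke Math. J. 170 (2021) = arXiv:1810.04493v2, Thm. 3.10 (a).
-/

namespace Literature.AlgebraicGeometry.Resolution

open Ideal Submodule Module IsLocalRing
open scoped Pointwise

universe u v

variable {R : Type u} [CommRing R] [IsNoetherianRing R] [IsLocalRing R]
variable {M : Type v} [AddCommGroup M] [Module R M] [Module.Finite R M]

namespace IsPStandard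

variable {xs : List R}

/-- **Kawasaki 2000, Theorem 2.9** (type `d - 1`). Let `xs = X₀ ++ D` be `p`-standard for `M`,
`ys = Y ++ [y_u] ⊆ 𝔪` a subsystem of parameters of `M/(D)M` (i.e. `D ++ ys` secant for `M`)
whose last element `y_u` kills the parameter colons of `M` or of `M/(D)M`. Then for every
`m < |ys|` (`y_v = ys[m]`, `(y₁,…,y_{v-1}) = ys.take m`) and every sublist `L` of `D` (`= x_Λ`,
`Λ ⊆ {i,…,d}`):
`(y₁,…,y_{v-1}, x_Λ)M :_M y_vy_u = (y₁,…,y_{v-1}, x_Λ)M :_M y_u` (2.9.1).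
Proof as printed: if `y_u` kills the parameter colons of `M` both sides are `(…)M : y_u` since
`…, y_vy_u` is again a subsystem of parameters; otherwise induct on `#({i,…,d} ∖ Λ)`: for
`Λ = {i,…,d}` use the hypothesis on `M/(D)M`; else let `l` be the largest index not in `Λ`,
`a ∈ (y_{<v}, x_Λ)M : y_vy_u ⊆ (y_{<v}, x_l, x_Λ)M : y_u` (induction), `y_ua = x_lb + c`,
`b ∈ (y_{<v}, x_Λ)M : y_vx_l = (y_{<v}, x_Λ)M : x_l` because `x_l` kills the parameter colons of
`M/(x_{l+1},…,x_d)M` and `l+1,…,d ∈ Λ`. [cite: Kawasaki2000, Thm. 2.9] -/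
theorem colonBy_mul_eq_colonBy (hx : IsPStandard M xs) {X₀ D : List R} (hxs : xs = X₀ ++ D)
    {ys : List R} (hys : IsSecantSequence M (D ++ ys)) (hym : ∀ y ∈ ys, y ∈ maximalIdeal R)
    {Y : List R} {yu : R} (hY : ys = Y ++ [yu])
    (hkill : KillsParameterColons M yu ∨
      KillsParameterColons (M ⧸ (ofList D • ⊤ : Submodule R M)) yu)
    {L : List R} (hL : L.Sublist D) {m : ℕ} (hm : m < ys.length) :
    colonBy (ofList (ys.take m ++ L) • ⊤ : Submodule R M) (ys[m] * yu) =
      colonBy (ofList (ys.take m ++ L) • ⊤) yu := by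
  classical
  have hS : ∀ r ∈ D ++ ys, r ∈ maximalIdeal R := fun r hr => by
    rcases List.mem_append.mp hr with hr | hr
    · exact hx.mem_maximalIdeal r (by rw [hxs]; exact List.mem_append_right X₀ hr)
    · exact hym r hr
  have hmY : m ≤ Y.length := by
    rw [hY, List.length_append, List.length_singleton] at hm; omega
  -- `ys.take m ++ [ys[m]]` and `ys.take m ++ [yu]` are sublists of `ys`
  have hTv : (ys.take m ++ [ys[m]]).Sublist ys := by
    rw [← List.take_succ_eq_append_getElem hm]
    exact List.take_sublist _ _
  have hTu : (ys.take m ++ [yu]).Sublist ys := by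
    conv_rhs => rw [hY]
    rw [hY, List.take_append_of_le_length hmY]
    exact (List.take_sublist m Y).append (List.Sublist.refl [yu])
  refine le_antisymm ?_ (colonBy_le_colonBy_mul _ _ _)
  rcases hkill with hk | hk
  · -- Case 1: `yu` kills the parameter colons of `M`; `(ys.take m, L), ys[m]·yu` is secant
    refine hk (ys.take m ++ L) (ys[m] * yu) (hys.append_mul_of_subperm hS ?_ ?_)
    · exact ⟨L ++ (ys.take m ++ [ys[m]]),
        List.perm_iff_count.mpr fun r => by simp only [List.count_append]; omega,
        hL.append hTv⟩
    · exact ⟨L ++ (ys.take m ++ [yu]),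
        List.perm_iff_count.mpr fun r => by simp only [List.count_append]; omega,
        hL.append hTu⟩
  · -- Case 2: `yu` kills the parameter colons of `M/(D)M`; induction on the gap `|D| - |L|`
    suffices key : ∀ (k : ℕ) (L : List R), L.Sublist D → D.length = L.length + k →
        colonBy (ofList (ys.take m ++ L) • ⊤ : Submodule R M) (ys[m] * yu) ≤
          colonBy (ofList (ys.take m ++ L) • ⊤) yu from
      key (D.length - L.length) L hL (by have := hL.length_le; omega)
    intro k
    induction k with
    | zero =>
      intro L hL hlen
      obtain rfl : L = D := hL.eq_of_length (by omega)
      -- `Λ = {i,…,d}`: the hypothesis on `M/(D)M`, read in `M`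
      have e : (ofList (ys.take m ++ L) : Ideal R) = ofList (L ++ ys.take m) :=
        ofList_eq_of_perm List.perm_append_comm
      rw [e]
      refine hk.colonBy_le_of_quotient (hys.append_mul_of_subperm hS ?_ ?_)
      · exact ⟨L ++ (ys.take m ++ [ys[m]]),
          List.perm_iff_count.mpr fun r => by simp only [List.count_append]; omega,
          (List.Sublist.refl L).append hTv⟩
      · exact ⟨L ++ (ys.take m ++ [yu]),
          List.perm_iff_count.mpr fun r => by simp only [List.count_append]; omega,
          (List.Sublist.refl L).append hTu⟩
    | succ k ih =>
      intro L hL hlen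
      have hne : L ≠ D := fun e => by rw [e] at hlen; omega
      obtain ⟨A, A', xl, B, hD, rfl, hA'⟩ := exists_eq_append_cons_of_sublist_of_ne hL hne
      -- induction hypothesis for `Λ ∪ {l}`, i.e. the sublist `A' ++ xl :: B`
      have hL' : (A' ++ xl :: B).Sublist D := by
        rw [hD]; exact hA'.append (List.Sublist.refl _)
      have ih' := ih (A' ++ xl :: B) hL' (by
        rw [hD] at hlen ⊢
        simp only [List.length_append, List.length_cons] at hlen ⊢
        omega)
      intro a ha
      -- `a ∈ (y_{<v}, x_l, x_Λ)M : y_v y_u = (y_{<v}, x_l, x_Λ)M : y_u`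
      have hsub : (ofList (ys.take m ++ (A' ++ B)) : Ideal R) ≤
          ofList (ys.take m ++ (A' ++ xl :: B)) :=
        ofList_mono_of_subset fun r hr => by
          simp only [List.mem_append, List.mem_cons] at hr ⊢; tauto
      have ha' : a ∈ colonBy (ofList (ys.take m ++ (A' ++ xl :: B)) • ⊤ : Submodule R M)
          (ys[m] * yu) :=
        colonBy_mono (Submodule.smul_mono_left hsub) _ ha
      -- write `y_u a = c + x_l b` with `c ∈ (y_{<v}, x_Λ)M`
      have hyua : yu • a ∈ (ofList (ys.take m ++ (A' ++ B)) • ⊤ : Submodule R M) ⊔ xl • ⊤ := by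
        have := ih' ha'
        rwa [mem_colonBy, ← List.append_assoc, ofList_append_cons_smul_top,
          List.append_assoc] at this
      obtain ⟨c, hc, b, hb⟩ := mem_sup_smul_top_iff.mp hyua
      -- `b ∈ (y_{<v}, x_Λ)M : y_v x_l`
      have hb1 : b ∈ colonBy (ofList (ys.take m ++ (A' ++ B)) • ⊤ : Submodule R M)
          (ys[m] * xl) := by
        rw [mem_colonBy]
        have e : (ys[m] * xl) • b = (ys[m] * yu) • a - ys[m] • c := by
          rw [mul_smul, mul_smul, hb, smul_add, add_sub_cancel_left]
        rw [e]
        exact Submodule.sub_mem _ ha (Submodule.smul_mem _ _ hc)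
      -- `x_l` kills the parameter colons of `M/(x_{l+1},…,x_d)M = M/(B)M`, and `l+1,…,d ∈ Λ`
      have hxl : KillsParameterColons (M ⧸ (ofList B • ⊤ : Submodule R M)) xl :=
        hx.kills (X₀ ++ A) xl B (by rw [hxs, hD, List.append_assoc])
      have eP : (ofList (ys.take m ++ (A' ++ B)) : Ideal R) = ofList (B ++ (ys.take m ++ A')) :=
        ofList_eq_of_perm (List.perm_iff_count.mpr fun r => by
          simp only [List.count_append]; omega)
      have hb2 : xl • b ∈ (ofList (ys.take m ++ (A' ++ B)) • ⊤ : Submodule R M) := by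
        rw [eP] at hb1 ⊢
        refine hxl.colonBy_le_of_quotient (hys.append_mul_of_subperm hS ?_ ?_) hb1
        · refine ⟨A' ++ (B ++ (ys.take m ++ [ys[m]])),
            List.perm_iff_count.mpr fun r => by simp only [List.count_append]; omega, ?_⟩
          rw [hD, List.append_assoc, List.cons_append]
          exact hA'.append (((List.Sublist.refl B).append hTv).cons xl)
        · refine ⟨A' ++ ([xl] ++ (B ++ ys.take m)),
            List.perm_iff_count.mpr fun r => by simp only [List.count_append]; omega, ?_⟩
          rw [hD, List.append_assoc, List.cons_append]
          exact hA'.append (((List.Sublist.refl B).append (List.take_sublist m ys)).cons_cons xl)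
      -- conclude: `y_u a = c + x_l b ∈ (y_{<v}, x_Λ)M`
      rw [mem_colonBy, hb]
      exact Submodule.add_mem _ hc hb2

/-- **Kawasaki 2000, Theorem 2.9, (2.9.2)** (the case `Λ = ∅`):
`(y₁,…,y_{v-1})M : y_vy_u = (y₁,…,y_{v-1})M : y_u`. [cite: Kawasaki2000, Thm. 2.9] -/
theorem colonBy_mul_eq_colonBy_nil (hx : IsPStandard M xs) {X₀ D : List R} (hxs : xs = X₀ ++ D)
    {ys : List R} (hys : IsSecantSequence M (D ++ ys)) (hym : ∀ y ∈ ys, y ∈ maximalIdeal R)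
    {Y : List R} {yu : R} (hY : ys = Y ++ [yu])
    (hkill : KillsParameterColons M yu ∨
      KillsParameterColons (M ⧸ (ofList D • ⊤ : Submodule R M)) yu)
    {m : ℕ} (hm : m < ys.length) :
    colonBy (ofList (ys.take m) • ⊤ : Submodule R M) (ys[m] * yu) =
      colonBy (ofList (ys.take m) • ⊤) yu := by
  have := hx.colonBy_mul_eq_colonBy hxs hys hym hY hkill (List.nil_sublist D) hm
  rwa [List.append_nil] at this

/-- **Kawasaki 2000, Corollary 2.10** (type `d - 1`): if `xs = X₀ ++ D` is `p`-standard for `M`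
and `ys ⊆ 𝔪` is a subsystem of parameters of `M/(D)M` (`D ++ ys` secant for `M`), then `D` is a
`d`-sequence on `M/(ys)M` in Kawasaki's sense: `((ys)M + (xᵢ,…,x_{j-1})M) : xⱼx_k =
((ys)M + (xᵢ,…,x_{j-1})M) : x_k` for `i ≤ j ≤ k ≤ d`. Proof as printed: apply (2.9.2) to the
subsystem of parameters `y₁,…,y_u,xᵢ,…,x_k` of `M/(x_{k+1},…,x_d)M`, whose last element `x_k`
kills the parameter colons of that module. In particular (`ys = []`) `x₁,…,x_d` is a
`d`-sequence on `M`. [cite: Kawasaki2000, Cor. 2.10] -/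
theorem isKDSequence (hx : IsPStandard M xs) {X₀ D : List R} (hxs : xs = X₀ ++ D)
    {ys : List R} (hys : IsSecantSequence M (D ++ ys)) (hym : ∀ y ∈ ys, y ∈ maximalIdeal R) :
    IsKDSequence (ofList ys • ⊤ : Submodule R M) D := by
  classical
  have hS : ∀ r ∈ D ++ ys, r ∈ maximalIdeal R := fun r hr => by
    rcases List.mem_append.mp hr with hr | hr
    · exact hx.mem_maximalIdeal r (by rw [hxs]; exact List.mem_append_right X₀ hr)
    · exact hym r hr
  intro A a B hD b hb
  -- the portion `xⱼ,…,x_k` of `D` from `a = xⱼ` to `b = x_k`: `a :: B = Q ++ E` with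
  -- `Q = Q₀ ++ [b]` starting with `a`
  obtain ⟨Q₀, E, hQ, hQa⟩ : ∃ Q₀ E : List R, a :: B = Q₀ ++ [b] ++ E ∧
      (Q₀ ++ [b]).head? = some a := by
    rcases List.mem_cons.mp hb with rfl | hb
    · exact ⟨[], B, rfl, rfl⟩
    · obtain ⟨C, E, rfl⟩ := List.append_of_mem hb
      exact ⟨a :: C, E, by simp, rfl⟩
  -- the enlarged subsystem of parameters `ys' = ys ++ A ++ Q₀ ++ [b]` of `M/(E)M`
  have hxs' : xs = (X₀ ++ A ++ Q₀ ++ [b]) ++ E := by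
    rw [hxs, hD, hQ]; simp only [List.append_assoc]
  have hys' : IsSecantSequence M (E ++ (ys ++ A ++ Q₀ ++ [b])) := by
    refine hys.of_perm ?_ hS
    rw [hD, hQ]
    exact List.perm_iff_count.mpr fun r => by
      simp only [List.count_append, List.count_cons, List.count_nil]; omega
  have hym' : ∀ y ∈ ys ++ A ++ Q₀ ++ [b], y ∈ maximalIdeal R := fun y hy => by
    refine hS y ?_
    rw [hD, hQ]
    simp only [List.mem_append, List.mem_cons, List.not_mem_nil] at hy ⊢
    tauto
  have hkill : KillsParameterColons M b ∨
      KillsParameterColons (M ⧸ (ofList E • ⊤ : Submodule R M)) b :=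
    Or.inr (hx.kills (X₀ ++ A ++ Q₀) b E
      (by rw [hxs', List.append_assoc _ [b] E, List.singleton_append]))
  have hm : (ys ++ A).length < (ys ++ A ++ Q₀ ++ [b]).length := by
    simp only [List.length_append, List.length_singleton]; omega
  have key := hx.colonBy_mul_eq_colonBy_nil hxs' hys' hym'
    (Y := ys ++ A ++ Q₀) (yu := b) rfl hkill hm
  -- identify `ys'.take |ys ++ A| = ys ++ A` and `ys'[|ys ++ A|] = a`
  have e1 : (ys ++ A ++ Q₀ ++ [b]).take (ys ++ A).length = ys ++ A := by
    rw [List.append_assoc (ys ++ A), List.take_left]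
  have e2 : (ys ++ A ++ Q₀ ++ [b])[(ys ++ A).length] = a := by
    simp only [List.append_assoc (ys ++ A), List.getElem_append_right le_rfl, Nat.sub_self]
    have h0 : 0 < (Q₀ ++ [b]).length := by simp
    rw [List.head?_eq_getElem?, List.getElem?_eq_getElem h0, Option.some.injEq] at hQa
    exact hQa
  rw [e1, e2, ofList_append, Submodule.sup_smul] at key
  exact key

/-- **`x₁,…,x_d` is a `d`-sequence on `M`** (Kawasaki 2000, Cor. 2.10, "in particular"), in the
tree's sense `IsDSequence` (via `M ⧸ ()M`). [cite: Kawasaki2000, Cor. 2.10] -/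
theorem isDSequence_quotient (hx : IsPStandard M xs) :
    IsDSequence (M ⧸ (ofList ([] : List R) • ⊤ : Submodule R M)) xs :=
  (hx.isKDSequence (X₀ := []) (D := xs) rfl (ys := []) (by simpa using hx.isSecantSequence)
    (by simp)).isDSequence_quotient

end IsPStandard

end Literature.AlgebraicGeometry.Resolution
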